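import Summits.HodgeConjecture.CorCM.IrreducibleOddWeightsCoreTowerExactLevels
import HarnessLib

/-!
# Core tower, VIII: the CANONICAL tower written out — `E₁` = Galois closure of the trace `K₁ ∩ L₀`, `E₂` = Galois
# closure of the trace `K₀ ∩ E₁`; the defect, the criterion and the exactness at level three with no auxiliary choices

COR-CM (cell `pub-hodgecm2`, binder seat `b16` gen 67, count-neutral claim CORE TOWER, file A8; theorems only, no
definition, no named fact, no `sorry`).  NEW as stated, hence under `Summits/`.  HONEST FRAMING: exact, hypothesis-free
formulas and type-free criteria for `Hg(A₀ × A₁) = Hg(A₀) × Hg(A₁)` (abelian varieties with complex multiplication by two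
CM fields); no Hodge class is claimed algebraic; `HC_CM` is neither used nor asserted.

SETTING (A2, A3, A7).  CM fields `K_{i₀}, K_{i₁}`, embeddings `a₀ : K_{i₀} → ℂ`, `b₀ : K_{i₁} → ℂ` (any; nothing depends on
the choice), `L₀ = normalClosure ℚ K_{i₀} ℂ`.  THE CANONICAL TOWER: `T₁ = b₀⁻¹(L₀) ≤ K_{i₁}` (the trace field of `L₀` on
`K_{i₁}`), `E₁ = normalClosure ℚ T₁ ℂ`; `T₂ = a₀⁻¹(E₁) ≤ K_{i₀}` (the trace field of `E₁` on `K_{i₀}`),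
`E₂ = normalClosure ℚ T₂ ℂ`; and so on — a decreasing sequence `L₀ ∩ L₁ ⊇ E₁ ⊇ E₂ ⊇ ⋯` of Galois CM-or-real fields.  Files
A2/A7 state every level for user-supplied fields `T`; here the first three levels are written with the canonical ones:

* `span_coeff_inf_eq_traceSum_inf_level_three` — **`MC₀ ∩ MC₁ = F₀^{E₂} ∩ F₁^{E₂}`**: the common matrix coefficients of
  ANY two types are common combinations of matrix coefficients summed over the classes of embeddings agreeing on the
  traces of `E₂`; `cmTypeRank_add_cmTypeRank_eq_…_level_three` — the exact defect there.
* `cmFamilyRank_add_card_eq_pair_of_forall_conj_apply_eq_level_three` — **`b(K_{i₁}) ∩ E₂ ⊂ ℝ` for every `b` ⟹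
  `Hg(A₀ × A₁) = Hg(A₀) × Hg(A₁)` for ALL CM types** (level two asked `a(K_{i₀}) ∩ E₁ ⊂ ℝ`, level one `b(K_{i₁}) ∩ L₀ ⊂ ℝ`).
* `forall_cmFamilyRank_add_card_eq_iff_level_three_of_normal_trace` — if `T₂` is normal over `ℚ` then additivity for all
  types **iff** `b(K_{i₁}) ∩ a₀(T₂) ⊂ ℝ` for every `b` (exactness at level three; A3/A4 had levels one and two).

## References

* [Gordon1999HodgeAVSurvey] B. B. Gordon, *A survey of the Hodge conjecture for abelian varieties*, §3 Theorem (proof),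
  7.5–7.7, 7.6.1.
* [MoonenZarhin1999LowDim] B. Moonen, Yu. Zarhin, Math. Ann. 315 (1999), Thm. (0.2).
* [Lang2002] S. Lang, *Algebra*, 3rd ed., VI §1 Thm. 1.1, Cor. 1.6, Thm. 1.12 and V §2 Thm. 2.8.
* [Deligne1982HodgeCycles] P. Deligne, *Hodge cycles on abelian varieties*, LNM 900 (1982), I.5 (p. 62).
-/

set_option autoImplicit false

noncomputable section

open scoped BigOperators Classical
open NumberField Module IntermediateField

namespace Summit.HodgeConjecture.CorCM

open Literature.NumberTheory.ComplexMultiplication Literature.AlgebraicGeometry.Pohlmann1968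
open Literature.AlgebraicGeometry.Motives (CMType)

section Tower

variable {I : Type} {K : I → Type} [∀ i, Field (K i)] [∀ i, NumberField (K i)]

/-- **LEVEL THREE OF THE CANONICAL TOWER: `MC₀ ∩ MC₁ = F₀^{E₂} ∩ F₁^{E₂}`** (trace-class form), `E₁` the Galois closure of
the trace field `b₀⁻¹(L₀) ≤ K_{i₁}`, `E₂` the Galois closure of the trace field `a₀⁻¹(E₁) ≤ K_{i₀}`: for ANY two CM types the
common matrix coefficients are the common combinations of the matrix coefficients of each slot summed over the classes
of embeddings agreeing on the trace of `E₂`. [cite: Gordon1999HodgeAVSurvey, §3 Theorem (proof)]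
[cite: Lang2002, VI §1 Thm. 1.1, Cor. 1.6 and Thm. 1.12] -/
theorem span_coeff_inf_eq_traceSum_inf_level_three (Φ : ∀ i, CMType (K i)) {i₀ i₁ : I} (a₀ : K i₀ →+* ℂ)
    (b₀ : K i₁ →+* ℂ) :
    Submodule.span ℚ (Set.range fun x : K i₀ →+* ℂ => fun g : ℂ ≃+* ℂ => antiVec (Φ i₀).1 g x) ⊓
        Submodule.span ℚ (Set.range fun x : K i₁ →+* ℂ => fun g : ℂ ≃+* ℂ => antiVec (Φ i₁).1 g x) =
      Submodule.span ℚ (Set.range fun a : K i₀ →+* ℂ => fun g : ℂ ≃+* ℂ =>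
          ∑ t ∈ Finset.univ.filter (fun t : K i₀ →+* ℂ => ∀ k : K i₀,
            a k ∈ normalClosure ℚ ↥((normalClosure ℚ ↥((normalClosure ℚ (K i₀) ℂ).comap b₀.toRatAlgHom) ℂ).comap
              a₀.toRatAlgHom) ℂ → t k = a k), antiVec (Φ i₀).1 g t) ⊓
        Submodule.span ℚ (Set.range fun a : K i₁ →+* ℂ => fun g : ℂ ≃+* ℂ =>
          ∑ t ∈ Finset.univ.filter (fun t : K i₁ →+* ℂ => ∀ k : K i₁,
            a k ∈ normalClosure ℚ ↥((normalClosure ℚ ↥((normalClosure ℚ (K i₀) ℂ).comap b₀.toRatAlgHom) ℂ).comap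
              a₀.toRatAlgHom) ℂ → t k = a k), antiVec (Φ i₁).1 g t) := by
  have h := span_coeff_inf_eq_of_traces_le_of_traces_le Φ i₀ i₁
    (T := ↥((normalClosure ℚ (K i₀) ℂ).comap b₀.toRatAlgHom))
    (T' := ↥((normalClosure ℚ ↥((normalClosure ℚ (K i₀) ℂ).comap b₀.toRatAlgHom) ℂ).comap a₀.toRatAlgHom))
    (fun b k hk => apply_mem_normalClosure_comap_of_mem (T := K i₀) b₀ b k hk)
    (fun a k hk => apply_mem_normalClosure_comap_of_mem
      (T := ↥((normalClosure ℚ (K i₀) ℂ).comap b₀.toRatAlgHom)) a₀ a k hk)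
  rw [stabAuxOrbitSum_eq_traceSum (Φ i₀), stabAuxOrbitSum_eq_traceSum (Φ i₁)] at h
  exact h

end Tower

section Rank

variable {I : Type} [Fintype I] {K : I → Type} [∀ i, Field (K i)] [∀ i, NumberField (K i)] [∀ i, IsCMField (K i)]

/-- **THE EXACT DEFECT AT LEVEL THREE**: `cmTypeRank Φ₀ + cmTypeRank Φ₁ = cmFamilyRank Φ + 1 + dim(F₀^{E₂} ∩ F₁^{E₂})`, i.e.
**`dim Hg(A₀) + dim Hg(A₁) − dim Hg(A₀ × A₁) = dim(F₀^{E₂} ∩ F₁^{E₂})`**, for ANY two CM fields and types.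
[cite: Gordon1999HodgeAVSurvey, §3 Theorem and 7.5–7.7] [cite: Deligne1982HodgeCycles, I.5 (p. 62)] -/
theorem cmTypeRank_add_cmTypeRank_eq_cmFamilyRank_add_one_add_finrank_level_three {i₀ i₁ : I} (h01 : i₀ ≠ i₁)
    (hI : ∀ l, l = i₀ ∨ l = i₁) (Φ : ∀ i, CMType (K i)) (a₀ : K i₀ →+* ℂ) (b₀ : K i₁ →+* ℂ) :
    cmTypeRank (Φ i₀) + cmTypeRank (Φ i₁) = CMAlgebra.cmFamilyRank Φ + 1 +
      Module.finrank ℚ (Submodule.span ℚ (Set.range fun a : K i₀ →+* ℂ => fun g : ℂ ≃+* ℂ =>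
            ∑ t ∈ Finset.univ.filter (fun t : K i₀ →+* ℂ => ∀ k : K i₀,
              a k ∈ normalClosure ℚ ↥((normalClosure ℚ ↥((normalClosure ℚ (K i₀) ℂ).comap b₀.toRatAlgHom) ℂ).comap
                a₀.toRatAlgHom) ℂ → t k = a k), antiVec (Φ i₀).1 g t) ⊓
          Submodule.span ℚ (Set.range fun a : K i₁ →+* ℂ => fun g : ℂ ≃+* ℂ =>
            ∑ t ∈ Finset.univ.filter (fun t : K i₁ →+* ℂ => ∀ k : K i₁,
              a k ∈ normalClosure ℚ ↥((normalClosure ℚ ↥((normalClosure ℚ (K i₀) ℂ).comap b₀.toRatAlgHom) ℂ).comap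
                a₀.toRatAlgHom) ℂ → t k = a k), antiVec (Φ i₁).1 g t) : Submodule ℚ ((ℂ ≃+* ℂ) → ℚ)) := by
  haveI : ∀ i, Nonempty (K i →+* ℂ) := fun i => inferInstance
  have h := IrrOdd.typeRank_add_typeRank_eq_of_pair (G := ℂ ≃+* ℂ) (E := fun i => K i →+* ℂ)
    (Φ := fun i => (Φ i).1) (fun i => isCMTypeWith_conj (Φ i)) hI h01
  rw [span_coeff_inf_eq_traceSum_inf_level_three Φ a₀ b₀] at h
  exact h

/-- **THE LEVEL-THREE CRITERION (canonical): if `b(K_{i₁}) ∩ E₂ ⊂ ℝ` for every embedding `b` — `E₂` the Galois closure of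
the trace of `E₁` on `K_{i₀}`, `E₁` that of the trace of `L₀` on `K_{i₁}` — then `Hg(A₀ × A₁) = Hg(A₀) × Hg(A₁)` for ALL CM
types.**  (Level one: `b(K_{i₁}) ∩ L₀ ⊂ ℝ`; level two: `a(K_{i₀}) ∩ E₁ ⊂ ℝ`; the fields shrink at each level.)
[cite: Gordon1999HodgeAVSurvey, §3 Theorem (proof) and 7.5–7.7] [cite: MoonenZarhin1999LowDim, Thm. (0.2)] -/
theorem cmFamilyRank_add_card_eq_pair_of_forall_conj_apply_eq_level_three {i₀ i₁ : I} (h01 : i₀ ≠ i₁)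
    (hI : ∀ l, l = i₀ ∨ l = i₁) (Φ : ∀ i, CMType (K i)) (a₀ : K i₀ →+* ℂ) (b₀ : K i₁ →+* ℂ)
    (hreal : ∀ (b : K i₁ →+* ℂ) (k : K i₁),
      b k ∈ normalClosure ℚ ↥((normalClosure ℚ ↥((normalClosure ℚ (K i₀) ℂ).comap b₀.toRatAlgHom) ℂ).comap
        a₀.toRatAlgHom) ℂ → starRingEnd ℂ (b k) = b k) :
    CMAlgebra.cmFamilyRank Φ + Fintype.card I = (∑ i, cmTypeRank (Φ i)) + 1 :=
  cmFamilyRank_add_card_eq_pair_of_traces_le_of_traces_le_of_forall_conj_apply_eq h01 hI Φ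
    (T := ↥((normalClosure ℚ (K i₀) ℂ).comap b₀.toRatAlgHom))
    (T' := ↥((normalClosure ℚ ↥((normalClosure ℚ (K i₀) ℂ).comap b₀.toRatAlgHom) ℂ).comap a₀.toRatAlgHom))
    (fun b k hk => apply_mem_normalClosure_comap_of_mem (T := K i₀) b₀ b k hk)
    (fun a k hk => apply_mem_normalClosure_comap_of_mem
      (T := ↥((normalClosure ℚ (K i₀) ℂ).comap b₀.toRatAlgHom)) a₀ a k hk) hreal

/-- **… then the pair is nondegenerate iff both members are.** [cite: Gordon1999HodgeAVSurvey, 7.5–7.6.1] -/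
theorem isNondegenerateFamily_iff_forall_of_forall_conj_apply_eq_level_three {i₀ i₁ : I} (h01 : i₀ ≠ i₁)
    (hI : ∀ l, l = i₀ ∨ l = i₁) (Φ : ∀ i, CMType (K i)) (a₀ : K i₀ →+* ℂ) (b₀ : K i₁ →+* ℂ)
    (hreal : ∀ (b : K i₁ →+* ℂ) (k : K i₁),
      b k ∈ normalClosure ℚ ↥((normalClosure ℚ ↥((normalClosure ℚ (K i₀) ℂ).comap b₀.toRatAlgHom) ℂ).comap
        a₀.toRatAlgHom) ℂ → starRingEnd ℂ (b k) = b k) :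
    CMAlgebra.IsNondegenerateFamily Φ ↔ ∀ i, IsNondegenerate (Φ i) := by
  haveI : Nonempty I := ⟨i₀⟩
  exact isNondegenerateFamily_iff_forall_of_cmFamilyRank_add_card_eq Φ
    (cmFamilyRank_add_card_eq_pair_of_forall_conj_apply_eq_level_three h01 hI Φ a₀ b₀ hreal)

/-- **EXACTNESS AT LEVEL THREE (canonical)**: if the trace field `T₂ = a₀⁻¹(E₁) ≤ K_{i₀}` is NORMAL over `ℚ`, then
`Hg(A₀ × A₁) = Hg(A₀) × Hg(A₁)` for ALL CM types **iff conjugation fixes `b(K_{i₁}) ∩ E₂` pointwise for every `b`**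
(`E₂ = a₀(T₂)`), iff no common subfield with a CM type.
[cite: Gordon1999HodgeAVSurvey, §3 Theorem (proof), 7.5–7.7 and 7.6.1] [cite: MoonenZarhin1999LowDim, Thm. (0.2)] -/
theorem forall_cmFamilyRank_add_card_eq_iff_level_three_of_normal_trace {i₀ i₁ : I} (h01 : i₀ ≠ i₁)
    (hI : ∀ l, l = i₀ ∨ l = i₁) (a₀ : K i₀ →+* ℂ) (b₀ : K i₁ →+* ℂ)
    (hn : Normal ℚ ↥((normalClosure ℚ ↥((normalClosure ℚ (K i₀) ℂ).comap b₀.toRatAlgHom) ℂ).comap a₀.toRatAlgHom)) :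
    (∀ Φ : ∀ i, CMType (K i), CMAlgebra.cmFamilyRank Φ + Fintype.card I = (∑ i, cmTypeRank (Φ i)) + 1) ↔
      ∀ (b : K i₁ →+* ℂ) (k : K i₁),
        b k ∈ normalClosure ℚ ↥((normalClosure ℚ ↥((normalClosure ℚ (K i₀) ℂ).comap b₀.toRatAlgHom) ℂ).comap
          a₀.toRatAlgHom) ℂ → starRingEnd ℂ (b k) = b k :=
  forall_cmFamilyRank_add_card_eq_iff_of_traces_le_of_normal_trace h01 hI a₀
    (T := ↥((normalClosure ℚ (K i₀) ℂ).comap b₀.toRatAlgHom))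
    (fun b k hk => apply_mem_normalClosure_comap_of_mem (T := K i₀) b₀ b k hk) hn

end Rank

end Summit.HodgeConjecture.CorCM

end
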